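import Summits.HubbardSuperconductivity.HubbardSuperconductivity.Theorems.NodalDiracTwistNodalDiracWeakCouplingOfConicalCore
import Summits.HubbardSuperconductivity.HubbardSuperconductivity.Theorems.NodalDiracTwistBridgeNodalToDWaveMomentumLocallyConstant
import Literature.MathematicalPhysics.QuantumLattice.SectorGroundProjContinuity

/-!
# The reflected polygon about a diagonal twist (crux `BridgeNodalToDWave`, line `birth`)

Route `HubbardSuperconductivity/NodalDiracTwist`, crux stmt-HubbardSuperconductivity-10395
(`BridgeNodalToDWave`), skeleton `Cruxes/BridgeNodalToDWave/Lines/birth.lean`, structural input to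
stub C (`stub_classificationCore`), lead c12.  Companion (part 1 of 2) of
`NodalDiracTwistBridgeNodalToDWaveDiagonalParityFlip.lean`, which proves the diagonal parity flip at
a Dirac point of the nodal-Dirac package.  This file supplies its three ingredients:

* `prod_overlap_reflectedLoop` — the algebra: for a polygon with `8m` vertices whose lower half is
  the image of its upper half under an inner-product preserving map `Γ`, and whose two junction
  vertices are `Γ`-eigenvectors with eigenvalues `d₊`, `d₋`, the cyclic overlap product equals
  `d₋ conj(d₊) |P|²`, `P` the product of the overlaps along the upper half
  (`prod_finRotate_eq_prod_range` converts the package's `finRotate` product to this form);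
* the mesh geometry of the `8m`-gon about a DIAGONAL twist `p` (`p₀ = p₁`): the swap of the two
  twist coordinates is `θ ↦ π/2 - θ`, i.e. `i ↦ 2m - i`, `i ↦ 10m - i` on mesh indices
  (`angle_reflect_lo/hi`, `angle_m`, `angle_5m`);
* the swap `(x₀, x₁) ↦ (x₁, x₀)` of the square torus, second-quantised as `U_{sr 3} = fockD4 (sr 3)`,
  transports `(N, S^z)` sector ground states of the spin-twisted torus across the diagonal,
  `H_L(U,(φ₀,φ₁)) ↝ H_L(U,(φ₁,φ₀))` (`isGroundStateInSector_swap`, from the landed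
  `swapCovariance`), and is a symmetry at diagonal twists (`relabel_swap_of_diagonal`);
  registered sub-goal `stub_swapTransport`.

## References

T. Fukui, Y. Hatsugai, H. Suzuki, J. Phys. Soc. Jpn. 74 (2005) 1674 (lattice link variables /
cyclic overlap products); D. J. Scalapino, Phys. Rep. 250 (1995) 329, §2 (point group of the square
lattice); O. Bratteli, D. W. Robinson, *Operator Algebras and Quantum Statistical Mechanics II*
(1997), §5.2.2, Thm. 5.2.5 (one-particle bijections are unitarily implemented). No new
definitions, no named facts.
-/

-- the mandated namespace repeats `HubbardSuperconductivity` (single-problem summit, D-0017)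
set_option linter.dupNamespace false

noncomputable section

namespace Summit.HubbardSuperconductivity.HubbardSuperconductivity.Theorems.NodalDiracTwist.BridgeNodalToDWave

open Matrix Finset Literature.MathematicalPhysics.QuantumLattice Literature.Probability.LatticeModels
open Summit.HubbardSuperconductivity.HubbardSuperconductivity.Theorems.NodalDiracTwist

/-! ### The reflected polygon: algebra of the cyclic overlap product -/

section ReflectedLoop

variable {ι : Type*} [Fintype ι]

/-- **Cyclic overlap product of a reflected polygon.**  Let `Γ` preserve inner products.  Let
`u_m, …, u_{5m}` be vectors (the upper half of a polygon with `8m` vertices) whose end points are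
unit `Γ`-eigenvectors, `Γ u_m = d₊ u_m`, `Γ u_{5m} = d₋ u_{5m}`, and let `Ψ` be the closed polygon
obtained by reflecting the upper half: `Ψ_i = Γ u_{2m-i}` (`i < m`), `Ψ_i = u_i` (`m ≤ i ≤ 5m`),
`Ψ_i = Γ u_{10m-i}` (`5m < i ≤ 8m`; so `Ψ_{8m} = Ψ_0`).  Then
`∏_{i<8m} ⟨Ψ_i, Ψ_{i+1}⟩ = d₋ conj(d₊) · conj(P) P`, `P = ∏_{m ≤ i < 5m} ⟨u_i, u_{i+1}⟩`:
the lower links are the conjugates of the upper links (unitarity of `Γ`), and the two junctions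
contribute `conj(d₊)` and `d₋`. Fukui–Hatsugai–Suzuki (2005) (link variables). [folklore] -/
theorem prod_overlap_reflectedLoop (Γ : (ι → ℂ) → (ι → ℂ))
    (hΓ : ∀ v w : ι → ℂ, star (Γ v) ⬝ᵥ Γ w = star v ⬝ᵥ w)
    {m : ℕ} (hm : 1 ≤ m) (u : ℕ → ι → ℂ) {dp dm : ℂ}
    (hdp : Γ (u m) = dp • u m) (hdm : Γ (u (5 * m)) = dm • u (5 * m))
    (h1p : star (u m) ⬝ᵥ u m = 1) (h1m : star (u (5 * m)) ⬝ᵥ u (5 * m) = 1)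
    (Ψ : ℕ → ι → ℂ) (hlo : ∀ i, i < m → Ψ i = Γ (u (2 * m - i)))
    (hmid : ∀ i, m ≤ i → i ≤ 5 * m → Ψ i = u i)
    (hhi : ∀ i, 5 * m < i → i ≤ 8 * m → Ψ i = Γ (u (10 * m - i))) :
    ∏ i ∈ range (8 * m), star (Ψ i) ⬝ᵥ Ψ (i + 1) =
      dm * star dp * (star (∏ i ∈ Ico m (5 * m), star (u i) ⬝ᵥ u (i + 1)) *
        ∏ i ∈ Ico m (5 * m), star (u i) ⬝ᵥ u (i + 1)) := by
  set f : ℕ → ℂ := fun i => star (Ψ i) ⬝ᵥ Ψ (i + 1) with hf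
  set g : ℕ → ℂ := fun j => star (u (j + 1)) ⬝ᵥ u j with hg
  set P : ℂ := ∏ i ∈ Ico m (5 * m), star (u i) ⬝ᵥ u (i + 1) with hP
  -- `|d±|² = 1`, and the reflected forms of the two junction vectors
  have hdp1 : star dp * dp = 1 := by
    have h := hΓ (u m) (u m)
    rw [hdp, star_smul, smul_dotProduct, dotProduct_smul, smul_smul, h1p, smul_eq_mul,
      mul_one] at h
    exact h
  have hdm1 : star dm * dm = 1 := by
    have h := hΓ (u (5 * m)) (u (5 * m))
    rw [hdm, star_smul, smul_dotProduct, dotProduct_smul, smul_smul, h1m, smul_eq_mul,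
      mul_one] at h
    exact h
  have hum : u m = star dp • Γ (u m) := by
    rw [hdp, smul_smul, hdp1, one_smul]
  have hu5 : u (5 * m) = star dm • Γ (u (5 * m)) := by
    rw [hdm, smul_smul, hdm1, one_smul]
  -- the upper links, conjugated
  have hF1 : ∏ i ∈ Ico m (5 * m), g i = star P := by
    rw [hP, star_prod]
    refine prod_congr rfl fun i _ => ?_
    exact star_dotProduct _ _
  -- the middle piece is `P`
  have hM : ∏ i ∈ Ico m (5 * m), f i = P := by
    refine prod_congr rfl fun i hi => ?_
    rw [mem_Ico] at hi
    simp only [hf]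
    rw [hmid i hi.1 hi.2.le, hmid (i + 1) (by omega) (by omega)]
  -- the two junction links
  have hj5 : f (5 * m) = dm * g (5 * m - 1) := by
    have h1 : f (5 * m) = star (u (5 * m)) ⬝ᵥ Γ (u (5 * m - 1)) := by
      simp only [hf]
      rw [hmid (5 * m) (by omega) le_rfl, hhi (5 * m + 1) (by omega) (by omega),
        show 10 * m - (5 * m + 1) = 5 * m - 1 from by omega]
    have h2 : g (5 * m - 1) = star (u (5 * m)) ⬝ᵥ u (5 * m - 1) := by
      simp only [hg]
      rw [show 5 * m - 1 + 1 = 5 * m from by omega]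
    rw [h1, h2]
    conv_lhs => rw [hu5]
    rw [star_smul, star_star, smul_dotProduct, hΓ, smul_eq_mul]
  have hjm : f (m - 1) = star dp * g m := by
    have h1 : f (m - 1) = star (Γ (u (m + 1))) ⬝ᵥ u m := by
      simp only [hf]
      rw [show m - 1 + 1 = m from by omega, hlo (m - 1) (by omega), hmid m le_rfl (by omega),
        show 2 * m - (m - 1) = m + 1 from by omega]
    rw [h1]
    conv_lhs => rw [hum]
    rw [dotProduct_smul, hΓ, smul_eq_mul]
  -- the high piece: `d₋ ∏_{2m ≤ j < 5m} g j`
  have hH : ∏ i ∈ Ico (5 * m) (8 * m), f i = dm * ∏ j ∈ Ico (2 * m) (5 * m), g j := by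
    rw [prod_eq_prod_Ico_succ_bot (show 5 * m < 8 * m by omega), hj5]
    have hinner : ∏ i ∈ Ico (5 * m + 1) (8 * m), f i =
        ∏ i ∈ Ico (5 * m + 1) (8 * m), g ((10 * m - 1) - i) := by
      refine prod_congr rfl fun i hi => ?_
      rw [mem_Ico] at hi
      simp only [hf, hg]
      rw [hhi i (by omega) (by omega), hhi (i + 1) (by omega) (by omega), hΓ,
        show 10 * m - (i + 1) = 10 * m - 1 - i from by omega,
        show 10 * m - 1 - i + 1 = 10 * m - i from by omega]
    have hrefl := prod_Ico_reflect g (5 * m + 1) (show 8 * m ≤ (10 * m - 1) + 1 by omega)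
    rw [show 10 * m - 1 + 1 - 8 * m = 2 * m from by omega,
      show 10 * m - 1 + 1 - (5 * m + 1) = 5 * m - 1 from by omega] at hrefl
    have hsplit : ∏ j ∈ Ico (2 * m) (5 * m), g j = (∏ j ∈ Ico (2 * m) (5 * m - 1), g j) * g (5 * m - 1) := by
      have h := prod_Ico_succ_top (show 2 * m ≤ 5 * m - 1 by omega) g
      rwa [show 5 * m - 1 + 1 = 5 * m from by omega] at h
    rw [hinner, hrefl, hsplit]
    ring
  -- the low piece: `conj(d₊) ∏_{m ≤ j < 2m} g j`
  have hLo : ∏ i ∈ range m, f i = star dp * ∏ j ∈ Ico m (2 * m), g j := by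
    have hsplit : ∏ i ∈ range m, f i = (∏ i ∈ range (m - 1), f i) * f (m - 1) := by
      have h := prod_range_succ f (m - 1)
      rwa [show m - 1 + 1 = m from by omega] at h
    have hinner : ∏ i ∈ range (m - 1), f i = ∏ i ∈ Ico 0 (m - 1), g ((2 * m - 1) - i) := by
      rw [range_eq_Ico]
      refine prod_congr rfl fun i hi => ?_
      rw [mem_Ico] at hi
      simp only [hf, hg]
      rw [hlo i (by omega), hlo (i + 1) (by omega), hΓ,
        show 2 * m - (i + 1) = 2 * m - 1 - i from by omega,
        show 2 * m - 1 - i + 1 = 2 * m - i from by omega]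
    have hrefl := prod_Ico_reflect g 0 (show m - 1 ≤ (2 * m - 1) + 1 by omega)
    rw [show 2 * m - 1 + 1 - (m - 1) = m + 1 from by omega,
      show 2 * m - 1 + 1 - 0 = 2 * m from by omega] at hrefl
    have hsplit' : ∏ j ∈ Ico m (2 * m), g j = g m * ∏ j ∈ Ico (m + 1) (2 * m), g j :=
      prod_eq_prod_Ico_succ_bot (show m < 2 * m by omega) g
    rw [hsplit, hinner, hrefl, hjm, hsplit']
    ring
  -- assemble
  calc ∏ i ∈ range (8 * m), f i
      = (∏ i ∈ range m, f i) * ((∏ i ∈ Ico m (5 * m), f i) * ∏ i ∈ Ico (5 * m) (8 * m), f i) := by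
        rw [prod_Ico_consecutive f (show m ≤ 5 * m by omega) (show 5 * m ≤ 8 * m by omega),
          prod_range_mul_prod_Ico f (show m ≤ 8 * m by omega)]
    _ = (star dp * ∏ j ∈ Ico m (2 * m), g j) * (P * (dm * ∏ j ∈ Ico (2 * m) (5 * m), g j)) := by
        rw [hLo, hM, hH]
    _ = dm * star dp * ((∏ j ∈ Ico m (2 * m), g j) * ∏ j ∈ Ico (2 * m) (5 * m), g j) * P := by
        ring
    _ = dm * star dp * (star P * P) := by
        rw [prod_Ico_consecutive g (show m ≤ 2 * m by omega) (show 2 * m ≤ 5 * m by omega), hF1]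
        ring

/-- The cyclic overlap product over `Fin n` with `finRotate` is the product of consecutive overlaps
of any `ℕ`-indexed extension `A` with `A n = A 0`. [folklore] -/
theorem prod_finRotate_eq_prod_range {n : ℕ} (hn : 1 ≤ n) (A : ℕ → ι → ℂ) (hA : A n = A 0) :
    ∏ i : Fin n, star (A i) ⬝ᵥ A (finRotate n i) = ∏ i ∈ range n, star (A i) ⬝ᵥ A (i + 1) := by
  obtain ⟨k, rfl⟩ : ∃ k, n = k + 1 := ⟨n - 1, by omega⟩
  rw [← Fin.prod_univ_eq_prod_range (fun i => star (A i) ⬝ᵥ A (i + 1)) (k + 1)]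
  refine Fintype.prod_congr _ _ fun i => ?_
  by_cases h : i = Fin.last k
  · subst h
    rw [finRotate_last, Fin.val_last, Fin.val_zero, ← hA]
  · rw [coe_finRotate_of_ne_last h]

end ReflectedLoop

/-! ### Geometry of the polygon about a diagonal point -/

section Geometry

/-- Mesh angles of the `8m`-gon: the reflection `i ↦ 2m - i` is `θ ↦ π/2 - θ`. [folklore] -/
theorem angle_reflect_lo {m i : ℕ} (hm : 1 ≤ m) (hi : i ≤ 2 * m) :
    2 * Real.pi * ((2 * m - i : ℕ) : ℝ) / ((8 * m : ℕ) : ℝ) =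
      Real.pi / 2 - 2 * Real.pi * (i : ℝ) / ((8 * m : ℕ) : ℝ) := by
  have hm' : (m : ℝ) ≠ 0 := by exact_mod_cast (show m ≠ 0 by omega)
  rw [Nat.cast_sub hi]
  push_cast
  field_simp
  ring

/-- Mesh angles of the `8m`-gon: the reflection `i ↦ 10m - i` is `θ ↦ π/2 - θ + 2π`. [folklore] -/
theorem angle_reflect_hi {m i : ℕ} (hm : 1 ≤ m) (hi : i ≤ 10 * m) :
    2 * Real.pi * ((10 * m - i : ℕ) : ℝ) / ((8 * m : ℕ) : ℝ) =
      Real.pi / 2 - 2 * Real.pi * (i : ℝ) / ((8 * m : ℕ) : ℝ) + 2 * Real.pi := by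
  have hm' : (m : ℝ) ≠ 0 := by exact_mod_cast (show m ≠ 0 by omega)
  rw [Nat.cast_sub hi]
  push_cast
  field_simp
  ring

/-- The vertex `i = m` of the `8m`-gon is at angle `π/4`. [folklore] -/
theorem angle_m {m : ℕ} (hm : 1 ≤ m) :
    2 * Real.pi * ((m : ℕ) : ℝ) / ((8 * m : ℕ) : ℝ) = Real.pi / 4 := by
  have hm' : (m : ℝ) ≠ 0 := by exact_mod_cast (show m ≠ 0 by omega)
  push_cast
  field_simp
  ring

/-- The vertex `i = 5m` of the `8m`-gon is at angle `5π/4`. [folklore] -/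
theorem angle_5m {m : ℕ} (hm : 1 ≤ m) :
    2 * Real.pi * ((5 * m : ℕ) : ℝ) / ((8 * m : ℕ) : ℝ) = 5 * Real.pi / 4 := by
  have hm' : (m : ℝ) ≠ 0 := by exact_mod_cast (show m ≠ 0 by omega)
  push_cast
  field_simp
  ring

end Geometry

/-! ### The swap and the spin-twisted torus -/

section Swap

variable (L : ℕ) [NeZero L]

/-- The two vector transports of the tree agree: `relabelVec π ψ = U_π ψ`. [folklore] -/
theorem relabelVec_eq_fockRelabel_mulVec {κ : Type*} [LinearOrder κ] [Fintype κ]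
    (π : Equiv.Perm κ) (ψ : Fock κ) : relabelVec π ψ = (fockRelabel π).val *ᵥ ψ := by
  funext s
  rw [fockRelabel_mulVec_apply]
  rfl

/-- **The swap transports sector ground states across the diagonal**: if `χ` is a ground state of
`H_L(U, (φ₀, φ₁))` in the sector `(N, S^z = M)`, then `U_{sr 3} χ` is one of `H_L(U, (φ₁, φ₀))`
(`swapCovariance` + `IsGroundStateInSector.relabelVec`). Scalapino, Phys. Rep. 250 (1995) 329, §2.
[folklore] -/
theorem isGroundStateInSector_swap {U : ℝ} {φ : Fin 2 → ℝ} {N : ℕ} {M : ℝ}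
    {χ : Fock (Orb (FermionTorus 2 L))}
    (hχ : IsGroundStateInSector (spinTwistedHubbardTorus L U φ) N M χ) :
    IsGroundStateInSector (spinTwistedHubbardTorus L U ![φ 1, φ 0]) N M
      ((fockD4 (L := L) (DihedralGroup.sr 3)).val *ᵥ χ) := by
  have h := hχ.relabelVec (FermionTorus.ofTorusEquiv (d4SitePerm (L := L) (DihedralGroup.sr 3)))
  rw [← Orb.d4Perm_eq_mapEquiv, swapCovariance, relabelVec_eq_fockRelabel_mulVec] at h
  exact h

/-- At a diagonal twist (`φ₀ = φ₁`) the swap is a symmetry of `H_L(U, φ)`. [folklore] -/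
theorem relabel_swap_of_diagonal (U : ℝ) {φ : Fin 2 → ℝ} (hφ : φ 0 = φ 1) :
    relabel (Orb.mapEquiv (FermionTorus.ofTorusEquiv (d4SitePerm (L := L) (DihedralGroup.sr 3))))
      (spinTwistedHubbardTorus L U φ) = spinTwistedHubbardTorus L U φ := by
  rw [← Orb.d4Perm_eq_mapEquiv, swapCovariance]
  congr 1
  funext ν
  fin_cases ν
  · simpa using hφ.symm
  · simpa using hφ

end Swap

/-- **Registered sub-goal `stub_swapTransport` of crux stmt-HubbardSuperconductivity-10395** (lead
c12, line `birth`; structural input to stub C): the statement of `isGroundStateInSector_swap` with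
all binders explicit and all names fully qualified — the swap `U_{sr 3}` maps `(N, S^z = M)` sector
ground states of `H_L(U, (φ₀, φ₁))` to sector ground states of `H_L(U, (φ₁, φ₀))`.
Scalapino, Phys. Rep. 250 (1995) 329, §2; Bratteli–Robinson II (1997) Thm. 5.2.5. [folklore] -/
theorem stub_swapTransport : ∀ (L : ℕ) [NeZero L] (U : ℝ) (φ : Fin 2 → ℝ) (N : ℕ) (M : ℝ) (χ : Literature.MathematicalPhysics.QuantumLattice.Fock (Literature.MathematicalPhysics.QuantumLattice.Orb (Literature.MathematicalPhysics.QuantumLattice.FermionTorus 2 L))), Literature.MathematicalPhysics.QuantumLattice.IsGroundStateInSector (Literature.MathematicalPhysics.QuantumLattice.spinTwistedHubbardTorus L U φ) N M χ → Literature.MathematicalPhysics.QuantumLattice.IsGroundStateInSector (Literature.MathematicalPhysics.QuantumLattice.spinTwistedHubbardTorus L U ![φ 1, φ 0]) N M (Matrix.mulVec (Literature.MathematicalPhysics.QuantumLattice.fockD4 (L := L) (DihedralGroup.sr 3)).val χ) :=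
  fun L _ _ _ _ _ _ hχ => isGroundStateInSector_swap L hχ

end Summit.HubbardSuperconductivity.HubbardSuperconductivity.Theorems.NodalDiracTwist.BridgeNodalToDWave

end
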